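import Summits.BirchSwinnertonDyer.BirchSwinnertonDyer.Theses.PrintCf2
import Summits.BirchSwinnertonDyer.BirchSwinnertonDyer.Theorems.PrintCf2RamifiedOffTYZSelmerRankOneOfFacts
import HarnessLib

/-!
# Route `PrintCf2`, aside item stmt-BirchSwinnertonDyer-24096 `RamifiedSelmerEightFiveOfFactsPlus` — CLOSED BY NAME
# (cell `bsd-print-cf2`, LEAD of crux 20509 g8, line `offtyz-v7`)

The planner's aside DOOR «the minimal-Selmer case of the congruent number problem at `p = 2` for `n ≡ 5 (mod 8)`, modulo the two
printed TYZ facts» (route rev 41, item 24096, booked «closable BY NAME now») is LITERALLY the `OfFacts` theorem of the LEAD g7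
(`MoverAssembly.selmerEight_mod_eight_five_bsdp_two_of_facts`, p694796).  This file records the closure.  For the planner's next revision:
the `n ≡ 7 (mod 8)` and all-odd companions proved by the LEAD g8 in the same `OfFacts` shape are ALREADY in the tree
(`MoverAssembly.selmerEight_mod_eight_seven_bsdp_two_of_facts_all`, `MoverAssembly.rankOne_sha_bsdp_two_of_selmerEight_of_facts_odd_all`,
`…SelmerRankOneSevenSplit`, p700170) and close verbatim asides by `exact`.  BSD is not proved by any of
this; the item closed is a conditional door (its own antecedent names the two prints).

References: [cite: TianYuanZhang2017, Thm. 1.1, Thm. 1.2, §3]; [cite: Smith2016CongruentDensity, Thm. 1.4, Thm. 2.2 row 7(a)];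
[cite: HeathBrown1994SelmerCongruentII, Appendix (Monsky)]; [cite: Miller2011LMS, Def. 1.1].
-/

noncomputable section

open Literature.NumberTheory.EllipticCurves Literature.NumberTheory.EllipticCurves.TianYuanZhang2017

-- the summit-side convention `Summit.<Summit>.<Problem>.Theorems.<decl>_proof` repeats the problem name (single-problem summit)
set_option linter.dupNamespace false

namespace Summit.BirchSwinnertonDyer.BirchSwinnertonDyer.Theorems

/-- **Item stmt-BirchSwinnertonDyer-24096 `PrintCf2.RamifiedSelmerEightFiveOfFactsPlus`, PROVED** (by name: the LEAD g7's
`MoverAssembly.selmerEight_mod_eight_five_bsdp_two_of_facts`): granted `tyz_cmPointRingClassFrobeniusData ∧ thm11_parity_of_scriptL`, every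
square-free `n ≡ 5 (mod 8)` with `#Sel₂(E_n) = 8` has `ord = rank = 1`, `Ш[2^∞] = 0`, `BSD(E_n, 2)`.
[cite: TianYuanZhang2017, Thm. 1.1 and §3] [cite: Smith2016CongruentDensity, Thm. 1.4] [cite: Miller2011LMS, Def. 1.1] -/
theorem ramifiedSelmerEightFiveOfFactsPlus_proof :
    Summit.BirchSwinnertonDyer.BirchSwinnertonDyer.Theses.PrintCf2.RamifiedSelmerEightFiveOfFactsPlus :=
  Summit.BirchSwinnertonDyer.PrintCf2.MoverAssembly.selmerEight_mod_eight_five_bsdp_two_of_facts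

end Summit.BirchSwinnertonDyer.BirchSwinnertonDyer.Theorems

end
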